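import Summits.SmoothPoincare4.SmoothPoincare4.Theses.CylinderEntropy

/-!
# SmoothPoincare4 / CylinderEntropy — assembly

Settles item stmt-SmoothPoincare4-7636 (assembly of route CylinderEntropy, rev 2):
`CylinderRungTwo → SliceIsolation → ThinCrossSectionExists → SmoothPoincare4`.

Pure logic.  For a Hausdorff second-countable smooth 4-manifold `M` homotopy equivalent to `S⁴`,
`ThinCrossSectionExists` supplies a smooth embedding `ι : M → ℝ⁶` into the round cylinder
`N = S⁴ × ℝ` separating the two ends with cylinder entropy `< 4/e`, and `CylinderRungTwo` turns such
an embedding into a diffeomorphism `M ≃ₘ S⁴`, which is exactly the shape of the problem statement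
`SmoothPoincare4` (`= Literature.SPC4.SmoothPoincareConjectureFour.{0}`).  The hypothesis
`SliceIsolation` is not used (it is implied by `CylinderRungTwo` with `ε = 4/e - 1`).  This is the
route file's own deciding theorem `CylinderEntropy.closes`; nothing else is used (no named facts).
-/

-- the registered namespace `Summit.SmoothPoincare4.SmoothPoincare4.Theorems` repeats a component
set_option linter.dupNamespace false

namespace Summit.SmoothPoincare4.SmoothPoincare4.Theorems

open Summit.SmoothPoincare4.SmoothPoincare4.Theses.CylinderEntropy

/-- Settles stmt-SmoothPoincare4-7636: the assembly
`CylinderRungTwo → SliceIsolation → ThinCrossSectionExists → SmoothPoincare4` of route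
CylinderEntropy.  Proof: discard the redundant hypothesis `SliceIsolation` and run the tail of the route's
deciding theorem `CylinderEntropy.closes` (unfold `SmoothPoincare4`, take the thin cross-section
`ι` of `M` given by `ThinCrossSectionExists`, feed it to `CylinderRungTwo`). [folklore] -/
theorem CylinderEntropy_Assembly_proof :
    Summit.SmoothPoincare4.SmoothPoincare4.Theses.CylinderEntropy.Assembly := by
  unfold Assembly
  intro hR _ hE
  -- buildfix 2026-08-20 (proof only; statement byte-identical): `closes` was re-cut to take
  -- `CylinderSurgeryResolution`/`NearSliceRecognition`/`RungTwoOfSurgeryResolution` and DERIVE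
  -- `CylinderRungTwo` first; the frame keeps `CylinderRungTwo`, so the proof is the remainder of
  -- `closes` verbatim (route file `Theses/CylinderEntropy.lean`), started at `hR`.
  unfold _root_.SmoothPoincare4 Literature.SPC4.SmoothPoincareConjectureFour
    ContinuousMap.HomotopyEquiv.NonemptyDiffeomorphSphere
  intro M _ _ _ _ _ e
  obtain ⟨ι, hι, hN', hsep, hlt⟩ := hE M e
  exact hR M e ι hι hN' hsep hlt

end Summit.SmoothPoincare4.SmoothPoincare4.Theorems
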